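import Literature.Probability.RandomPlanarGeometry.HexSAWStripBetaHeadTailMasses
import Mathlib.Analysis.Normed.Group.Tannery
import HarnessLib

/-!
# The length amplitude and the contact amplitude of the critical honeycomb strip differ by the ratio of the first moments of an
# irreducible bridge: the rank-one residues in BOTH fugacities made explicit, `Λℓ_T · ⟨steps⟩ = 2 Λ_T · ⟨contacts⟩` (module «AMPLITUDE-RATIO»)

Topic `Literature/Probability/RandomPlanarGeometry` (continues the two renewal chapters of the strip line: the CONTACT chapter —
`HexSAWStripBridgeKernelResidue.lean` (`HV.exists_tendsto_hKernel_residue`: `(y_T − y) D_{ab}(y) → ρ u_a ℓ_b`, `ρ` unidentified),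
`HexSAWStripBridgeCoefficientRenewal.lean` (`HV.hKernel_eq_Iinf_add_sum_mul`, `HV.tendsto_hbCoeff_mul_pow_of_residue`),
`HexSAWStripIrreducibleBridgeMean.lean` (`HV.tendsto_Iinf_tsum_irCoeff_stripYT`, the finite mean contact number
`HV.exists_tsum_mul_irCoeff_mul_pow_le`), «BETA-COEFF» `HexSAWStripBetaCoefficientLaw.lean` (`HV.exists_tendsto_stripBcoeff_mul_pow`:
`β_{T,m} y_T^m → (2ρ/y_T)(Σ F_a u_a)(Σ ℓ_b G_b)`) — and the LENGTH chapter — «LENGTH-NEUMANN» `HexSAWStripBridgeLengthResidue.lean`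
(`HV.exists_tendsto_stripLenD_residue`: `(1 − s) D_T(s)_{ab} → ρ′u′_aℓ′_b`, data unidentified; `HV.stripLenD_eq_stripLenI_add_mul`, the finite
mean length `HV.summable_length_mul_LMM`, `HV.summable_LMM_stripYT`, `HV.tendsto_Imat_stripYT`), «LENGTH-POINTWISE-LAW»
(`HV.exists_tendsto_LUM_parity`), «BETA-LENGTH-LAW» `HexSAWStripBetaLengthLaw.lean` (`HV.exists_tendsto_betaLenSum_even`:
`bℓ_T(2m)(y_T) → 4ρ′(Σ Fℓ_a u′_a)(Σ ℓ′_b Gℓ_b)`), «BETA-HEAD-TAIL-MASSES» (`HV.headLenGF_eq_headGF`: the head / tail masses are the same in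
both gradings); tool: the tree's spectral-theory-free uniqueness of positive fixed vectors `Literature.Analysis.Matrix.exists_eq_smul_of_mulVec_eq`
(`NonnegMatrixFamilyResidue.lean` §B) and Mathlib's Tannery theorem).  Lane «pcv-sawmu» (CriticalPhenomena venture), a-p2 g23 — the
question left open at the end of both chapters («NOT claimed: an identification of `Λ_T` in closed form», «a closed form of `Λℓ_T` or its
relation to the contact-law amplitude `Λ_T`», HANDOFF a-p2 g22 §Recommended 5).

Sources of the SETTING: W. Feller, vol. I (1968) XIII.11 (renewal with delay: the limit is (mass of the delay)·(1/mean recurrence time));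
E. Seneta, Non-negative Matrices (1973) §6.2 Theorem 6.3 (R-positivity: positive left/right vectors and a finite derivative at the convergence
parameter) and §1.4 (uniqueness of the positive eigenvector); G. Giacomin, *Disorder and critical phenomena through basic probability models*,
LNM 2025 (2011), Ch. 2, (2.9)–(2.11) (the ONE-type template: for the homogeneous pinning model the contact fraction is `F′(h) = 1/E τ̃₁^{(h)}`,
one over the mean inter-arrival of the tilted renewal); H. Duminil-Copin, A. Hammond, CMP 324 (2013) §2.2 (bridges, renewal points, irreducible
bridges — here along the column of the width-`T` strip); N. R. Beaton, M. Bousquet-Mélou, J. de Gier, H. Duminil-Copin, A. J. Guttmann, CMP 326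
(2014), arXiv:1109.0358v5, §3.2 and Corollary 8 (p. 12: the series `B_T(x; y)`, its `y`-radius `y_T` at `x = x_c` and its `x`-radius `x_c` at
`y = y_T`).  Nothing below is printed for the strip: in print the strip series are rational and both residues would be read off a
Perron–Frobenius eigenvalue `λ_T(x, y)` of a transfer matrix by Hellmann–Feynman (`∂_yλ = ℓ(∂_y I)u/ℓu`, `∂_xλ = ℓ(∂_x I)u/ℓu`); the lane's
route has no transfer matrix and no spectral theory — the two residues are pinned by the renewal equations alone.

## The argument (§3, generic)
Let `D(t) = I(t) + I(t) D(t)` entrywise near the left of `R₀`, `I(t) → I₀`, `(R₀ − t) D(t) → Res`, `(I₀ − I(t))/(R₀ − t) → J`.  Multiplying the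
renewal equation by `R₀ − t` gives `I₀ Res = Res` (every column of `Res` is right-fixed); multiplying it on the left by a left fixed vector `ℓ`
of `I₀` and using `ℓ(1 − I(t)) = ℓ(I₀ − I(t))` gives, after division by `R₀ − t`, `ℓ (J Res) = ℓ`.  If `I₀ ≥ 0` is irreducible with a positive
right fixed vector `u`, each column of `Res` is `t_b u` (minimum-ratio argument, tree), and the second identity pins `t_b = ℓ_b/(ℓ · J u)`:
`Res_{ab} = u_a ℓ_b/(ℓ · J u)`.  For the strip both families (`y ↦ Iinf T y` at `x = x_c`, `s ↦ I_T(s)` at `y = y_T`) end at the SAME kernel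
`Iinf T y_T` (§1) and their endpoint slopes are the first-moment matrices in contacts and in steps (§2, dominated convergence); so the two
residues are `u ℓᵀ/⟨ℓ, M̄_top u⟩` and `u ℓᵀ/⟨ℓ, M̄_len u⟩` with the SAME `u`, `ℓ` (§4), and the β-walk amplitudes inherit the ratio (§5).

## What is proved (namespace `Literature.Probability.RandomPlanarGeometry.SAW.HV`; `y_T = stripYT T`, `I_T = Iinf T y_T`; `T ≥ 2` throughout;
## `M̄_len = (Σ_n n·M(n)_{ab})_{ab}`, `M(n) = LMM T n n y_T`; `M̄_top = (Σ_j j·m_{ab}(j) y_T^{j−1})_{ab}`, `m(j) = irCoeff T j`; `⟨ℓ, A u⟩ = ℓ ⬝ᵥ (A *ᵥ u)`)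

* §1 `Iinf_stripYT_eq_tsum_LMM` (`I_T = Σ_n M(n)`), `Imat_le_Iinf_stripYT`, `Iinf_le_Iinf_stripYT`, ★ `tendsto_Iinf_stripYT` (`I(y) → I_T` as `y ↑ y_T`,
  and `Σ_j m(j) y_T^j = I_T`), ★ `tendsto_stripLenI_one` (`I_T(s) → I_T` as `s ↑ 1`), `Iinf_stripYT_nonneg_irred`.
* §2 ★★ `tendsto_slope_stripLenI` — `(I_T − I_T(s))/(1 − s) → M̄_len`; ★★ `tendsto_slope_Iinf` — `(I_T − I(y))/(y_T − y) → M̄_top`: the endpoint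
  slopes of the two generating families ARE the first-moment matrices (both finite, tree).
* §3 (generic, any finite index type) `mul_residue_eq_of_renewal` (`I₀ Res = Res`), `vecMul_slope_mul_residue_eq_of_renewal` (`ℓ (J Res) = ℓ`),
  ★★ `residue_eq_of_renewal` (`Res_{ab} = u_a ℓ_b/(ℓ · J u)`, `ℓ · J u ≠ 0`).
* §4 `exists_pos_fixed_vectors_Iinf_stripYT`; ★★★ `tendsto_hKernel_residue_explicit` — for ANY positive right/left fixed vectors `u, ℓ` of `I_T`:
  `⟨ℓ, M̄_top u⟩ > 0` and `(y_T − y) D_{ab}(y) → u_a ℓ_b/⟨ℓ, M̄_top u⟩`; ★★★ `tendsto_stripLenD_residue_explicit` — `⟨ℓ, M̄_len u⟩ > 0` and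
  `(1 − s) D_T(s)_{ab} → u_a ℓ_b/⟨ℓ, M̄_len u⟩`; ★★★ `lenResidue_mul_eq_contactResidue_mul` — the two residues are PROPORTIONAL with the
  level-independent factor `κ_T = ⟨ℓ, M̄_top u⟩/⟨ℓ, M̄_len u⟩`.
* §5 ★★ `bridge_amplitudes_explicit` (`d_{ab}(m) y_T^m → u_aℓ_b/(y_T⟨ℓ, M̄_top u⟩)`, `D(2k + χ_a − χ_b)_{ab} → 2u_aℓ_b/⟨ℓ, M̄_len u⟩`);
  ★★★ `beta_amplitudes_explicit` (`Λ · y_T ⟨ℓ, M̄_top u⟩ = 2(Σ F_a u_a)(Σ ℓ_b G_b)`, `Λℓ · ⟨ℓ, M̄_len u⟩ = 4(Σ F_a u_a)(Σ ℓ_b G_b)`);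
  ★★★★ `lengthAmplitude_mul_meanSteps_eq` — `Λℓ · ⟨ℓ, M̄_len u⟩ = 2 Λ · y_T ⟨ℓ, M̄_top u⟩`; ★★★ `lengthAmplitude_mul_bridgeContact_eq` — the
  fixed-vector-free form `Λℓ · lim_m d_{ab}(m) y_T^m = Λ · lim_k D(2k + χ_a − χ_b)_{ab}` for EVERY pair of levels; `exists_amplitude_ratio` (packaged).

Label: LANE THEOREM (own result of lane «pcv-sawmu», a-p2 g23, 2026-08-27); the classical content is the Markov-renewal formula «renewal
constant = 1/(ℓ · mean · u)» (Feller / Seneta / Giacomin's one-type (2.11)), here in both gradings of one kernel, whence the ratio.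
NOT claimed: `T = 1` (excluded by `T ≥ 2`; there everything is explicit in the tree), a closed form of either amplitude alone, the value of
`κ_T` or its behaviour in `T`, differentiability of a critical curve `y ↦ x_T(y)` (of which `−1/(x_c κ_T)` would be the slope at `y_T`), rates.
No new definitions: the moment matrices are written out as `Matrix.of fun a b => ∑' …` in every statement.

Edition 2 (append-only, a-p2 g23): §6 ★★ `exitLaws_agree` / ★★ `entranceLaws_agree` — the exit law (∝ `ℓ`) and the entrance law (∝ `u`) of a
long critical bridge are the SAME vectors whether «long» is counted in surface contacts or in steps (the tree's two exit laws had separate,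
unidentified vectors); and the locator erratum of ref g68 (Seneta §6.2 Theorem 6.4, not 6.3, for the finite derivative at `R`), recorded
in the new docstring.
-/

noncomputable section

open Finset Filter Topology Matrix Literature.Probability.LatticeModels Literature.Probability.Percolation
  Literature.Analysis.Matrix

namespace Literature.Probability.RandomPlanarGeometry.SAW

namespace HV

variable {T : ℕ}

/-! ### §1 The critical irreducible kernel `I_T := Iinf T y_T` as the common endpoint of the two families -/

section CriticalKernel

/-- At the threshold the truncated kernels increase to the full one: `Iinf T y_T = Σ_n M(n)(y_T)` entrywise (`T ≥ 2`), with
`M(n) = LMM T n n y_T` the `x_c^n y_T^{#top}`-weight of the irreducible standard horizontal bridges with `n` steps.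
[cite: Seneta1973, §6.2; DuminilCopinHammond2013, §2.2 (irreducible bridges); lane plumbing a-p2 g23] -/
theorem Iinf_stripYT_eq_tsum_LMM (hT : 2 ≤ T) (a b : Fin (2 * T)) :
    Iinf T (stripYT T) a b = ∑' n : ℕ, LMM T n (n : ℤ) (stripYT T) a b := by
  have hT1 : 1 ≤ T := by omega
  have hy : 0 ≤ stripYT T := (stripYT_pos hT1).le
  have hmono : Monotone fun N : ℕ => Imat T N (stripYT T) a b := fun N N' h => Imat_mono_N h hy a b
  have hlim := tendsto_Imat_stripYT hT a b
  have hbdd : BddAbove (Set.range fun N : ℕ => Imat T N (stripYT T) a b) :=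
    ⟨_, by rintro _ ⟨N, rfl⟩; exact hmono.ge_of_tendsto hlim N⟩
  exact tendsto_nhds_unique (tendsto_atTop_ciSup hmono hbdd) hlim

/-- Every truncation lies below the critical kernel: `I_N(y_T)_{ab} ≤ (Iinf T y_T)_{ab}` (`T ≥ 2`).
[cite: Seneta1973, §6.2; DuminilCopinHammond2013, §2.2; lane plumbing a-p2 g23] -/
theorem Imat_le_Iinf_stripYT (hT : 2 ≤ T) (N : ℕ) (a b : Fin (2 * T)) :
    Imat T N (stripYT T) a b ≤ Iinf T (stripYT T) a b := by
  have hT1 : 1 ≤ T := by omega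
  have hy : 0 ≤ stripYT T := (stripYT_pos hT1).le
  have hmono : Monotone fun N : ℕ => Imat T N (stripYT T) a b := fun N N' h => Imat_mono_N h hy a b
  rw [Iinf_stripYT_eq_tsum_LMM hT]
  exact hmono.ge_of_tendsto (tendsto_Imat_stripYT hT a b) N

/-- Below the threshold the kernel lies below the critical kernel: `I(y)_{ab} ≤ (Iinf T y_T)_{ab}` for `1 ≤ y < y_T` (`T ≥ 2`).
[cite: Seneta1973, §6.2; DuminilCopinHammond2013, §2.2; lane plumbing a-p2 g23] -/
theorem Iinf_le_Iinf_stripYT (hT : 2 ≤ T) {y : ℝ} (hy : y ∈ Set.Ico 1 (stripYT T)) (a b : Fin (2 * T)) :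
    Iinf T y a b ≤ Iinf T (stripYT T) a b :=
  ciSup_le fun N => (Imat_mono_y (zero_le_one.trans hy.1) hy.2.le a b).trans (Imat_le_Iinf_stripYT hT N a b)

/-- ★ **The contact family ends at the critical kernel**: `I(y)_{ab} → (Iinf T y_T)_{ab}` as `y ↑ y_T` (`T ≥ 2`) — the limit kernel `I_T` of
the residue theorem `exists_tendsto_hKernel_residue` IS `Iinf T y_T`; and `Σ_j m_{ab}(j) y_T^j = (Iinf T y_T)_{ab}` (the contact grading of
the same kernel). [cite: Seneta1973, §6.2 Theorem 6.3; DuminilCopinHammond2013, §2.2; lane plumbing a-p2 g23] -/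
theorem tendsto_Iinf_stripYT (hT : 2 ≤ T) (a b : Fin (2 * T)) :
    Tendsto (fun y => Iinf T y a b) (𝓝[<] stripYT T) (𝓝 (Iinf T (stripYT T) a b)) ∧
      ∑' j : ℕ, irCoeff T j a b * stripYT T ^ j = Iinf T (stripYT T) a b := by
  have hT1 : 1 ≤ T := by omega
  have hlim := tendsto_Iinf_tsum_irCoeff_stripYT hT a b
  set L := ∑' j : ℕ, irCoeff T j a b * stripYT T ^ j
  have hLe : L ≤ Iinf T (stripYT T) a b :=
    le_of_tendsto hlim (by
      filter_upwards [Ico_mem_nhdsLT (one_lt_stripYT hT1)] with y hy using Iinf_le_Iinf_stripYT hT hy a b)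
  have hGe : Iinf T (stripYT T) a b ≤ L := by
    rw [Iinf_stripYT_eq_tsum_LMM hT]
    refine le_of_tendsto' (tendsto_Imat_stripYT hT a b) fun N => ?_
    exact Imat_stripYT_le_of_tendsto hT1 (IT := Matrix.of fun a b => ∑' j : ℕ, irCoeff T j a b * stripYT T ^ j)
      (fun a b => by rw [Matrix.of_apply]; exact tendsto_Iinf_tsum_irCoeff_stripYT hT a b) N a b
  have hEq : L = Iinf T (stripYT T) a b := le_antisymm hLe hGe
  exact ⟨hEq ▸ hlim, hEq⟩

/-- ★ **The length family ends at the same kernel**: `I_T(s)_{ab} = Σ_n M(n)_{ab} s^n → (Iinf T y_T)_{ab}` as `s ↑ 1` (`T ≥ 2`; monotone /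
dominated convergence, `Σ_n M(n) < ∞`). [cite: Seneta1973, §6.2; DuminilCopinHammond2013, §2.2; lane plumbing a-p2 g23] -/
theorem tendsto_stripLenI_one (hT : 2 ≤ T) (a b : Fin (2 * T)) :
    Tendsto (fun s => stripLenI T s a b) (𝓝[<] 1) (𝓝 (Iinf T (stripYT T) a b)) := by
  have hT1 : 1 ≤ T := by omega
  have hy : 0 ≤ stripYT T := (stripYT_pos hT1).le
  have hM0 : ∀ n : ℕ, 0 ≤ LMM T n (n : ℤ) (stripYT T) a b := fun n => (LMM_LUM_nonneg hy _ a b).1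
  rw [Iinf_stripYT_eq_tsum_LMM hT]
  have h := tendsto_tsum_of_dominated_convergence (𝓕 := 𝓝[<] (1 : ℝ))
    (f := fun (s : ℝ) (n : ℕ) => LMM T n (n : ℤ) (stripYT T) a b * s ^ n)
    (g := fun n : ℕ => LMM T n (n : ℤ) (stripYT T) a b)
    (bound := fun n : ℕ => LMM T n (n : ℤ) (stripYT T) a b) (summable_LMM_stripYT hT a b)
    (fun n => by
      have : Tendsto (fun s : ℝ => LMM T n (n : ℤ) (stripYT T) a b * s ^ n) (𝓝 1)
          (𝓝 (LMM T n (n : ℤ) (stripYT T) a b * 1 ^ n)) := ((continuous_pow n).tendsto 1).const_mul _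
      rw [one_pow, mul_one] at this
      exact this.mono_left nhdsWithin_le_nhds)
    (by
      filter_upwards [Ico_mem_nhdsLT zero_lt_one] with s hs n
      rw [Real.norm_eq_abs, abs_of_nonneg (mul_nonneg (hM0 n) (pow_nonneg hs.1 _))]
      exact mul_le_of_le_one_right (hM0 n) (pow_le_one₀ hs.1 hs.2.le))
  exact h

/-- The critical kernel is entrywise non-negative and irreducible (`T ≥ 2`).
[cite: Seneta1973, §1.1, §6.2; DuminilCopinHammond2013, §2.2; lane plumbing a-p2 g23] -/
theorem Iinf_stripYT_nonneg_irred (hT : 2 ≤ T) :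
    (∀ a b : Fin (2 * T), 0 ≤ Iinf T (stripYT T) a b) ∧ ∀ a b : Fin (2 * T), ∃ j : ℕ, 0 < (Iinf T (stripYT T) ^ j) a b := by
  have hT1 : 1 ≤ T := by omega
  have h1 : (1 : ℝ) ∈ Set.Ico 1 (stripYT T) := ⟨le_rfl, one_lt_stripYT hT1⟩
  have hnn : ∀ a b : Fin (2 * T), 0 ≤ Iinf T (stripYT T) a b := fun a b =>
    (Iinf_nonneg hT1 h1 a b).trans (Iinf_le_Iinf_stripYT hT h1 a b)
  refine ⟨hnn, fun a b => ?_⟩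
  obtain ⟨j, hj⟩ := Iinf_irred hT1 h1 a b
  exact ⟨j, hj.trans_le (nonnegMat_pow_apply_mono (Iinf_nonneg hT1 h1) (fun a b => Iinf_le_Iinf_stripYT hT h1 a b) j a b)⟩

end CriticalKernel

/-! ### §2 The first-moment matrices of the critical irreducible bridges as the endpoint slopes of the two families -/

section Moments

/-- ★★ **The mean-length matrix is the endpoint slope of the length family**: for all levels `a, b` (`T ≥ 2`),
`((Iinf T y_T)_{ab} − I_T(s)_{ab})/(1 − s) ⟶ Σ_n n · M(n)_{ab}` as `s ↑ 1`,
where `M(n)_{ab}` is the `x_c^n y_T^{#top}`-weight of the irreducible standard horizontal bridges `a → b` with `n` steps: the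
left derivative of the length generating matrix at `s = 1` is the first moment of the number of steps (finite by the tree's
`summable_length_mul_LMM`; dominated convergence of `(1 − s^n)/(1 − s) ↑ n`).
[cite: Seneta1973, §6.2 Theorem 6.3 (finite derivative at the convergence parameter); Feller1968, XIII.11 (mean recurrence time); DuminilCopinHammond2013, §2.2; lane «pcv-sawmu» a-p2 g23 — own] -/
theorem tendsto_slope_stripLenI (hT : 2 ≤ T) (a b : Fin (2 * T)) :
    Tendsto (fun s => (Iinf T (stripYT T) a b - stripLenI T s a b) / (1 - s)) (𝓝[<] 1)
      (𝓝 (∑' n : ℕ, (n : ℝ) * LMM T n (n : ℤ) (stripYT T) a b)) := by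
  have hT1 : 1 ≤ T := by omega
  have hy : 0 ≤ stripYT T := (stripYT_pos hT1).le
  set M : ℕ → ℝ := fun n => LMM T n (n : ℤ) (stripYT T) a b with hM
  have hM0 : ∀ n : ℕ, 0 ≤ M n := fun n => (LMM_LUM_nonneg hy _ a b).1
  have hsM : Summable M := summable_LMM_stripYT hT a b
  have hsnM : Summable fun n : ℕ => (n : ℝ) * M n := summable_length_mul_LMM hT a b
  -- the dominated family `g s n = M n · Σ_{k<n} s^k`
  have hgeom_le : ∀ s ∈ Set.Ico (0 : ℝ) 1, ∀ n : ℕ, ∑ k ∈ range n, s ^ k ≤ n := fun s hs n => by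
    calc ∑ k ∈ range n, s ^ k ≤ ∑ _k ∈ range n, (1 : ℝ) := sum_le_sum fun k _ => pow_le_one₀ hs.1 hs.2.le
      _ = n := by simp
  have hlim : Tendsto (fun s : ℝ => ∑' n : ℕ, M n * ∑ k ∈ range n, s ^ k) (𝓝[<] 1) (𝓝 (∑' n : ℕ, (n : ℝ) * M n)) := by
    have h := tendsto_tsum_of_dominated_convergence (𝓕 := 𝓝[<] (1 : ℝ))
      (f := fun (s : ℝ) (n : ℕ) => M n * ∑ k ∈ range n, s ^ k) (g := fun n : ℕ => (n : ℝ) * M n)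
      (bound := fun n : ℕ => (n : ℝ) * M n) hsnM
      (fun n => by
        have hc : Continuous fun s : ℝ => M n * ∑ k ∈ range n, s ^ k :=
          continuous_const.mul (continuous_finsetSum _ fun k _ => continuous_pow k)
        have := hc.tendsto 1
        have hval : M n * ∑ k ∈ range n, (1 : ℝ) ^ k = (n : ℝ) * M n := by simp [mul_comm]
        rw [hval] at this
        exact this.mono_left nhdsWithin_le_nhds)
      (by
        filter_upwards [Ico_mem_nhdsLT zero_lt_one] with s hs n
        rw [Real.norm_eq_abs, abs_of_nonneg (mul_nonneg (hM0 n) (sum_nonneg fun k _ => pow_nonneg hs.1 _)), mul_comm]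
        exact mul_le_mul_of_nonneg_right (hgeom_le s hs n) (hM0 n))
    exact h
  -- identify the family with the slope on `[0,1)`
  refine hlim.congr' ?_
  filter_upwards [Ico_mem_nhdsLT zero_lt_one] with s hs
  have hs1 : (1 : ℝ) - s ≠ 0 := sub_ne_zero.2 (ne_of_gt hs.2)
  obtain ⟨-, -, hMs⟩ := lenSlices_basic hT1 a b hs.1 hs.2
  rw [eq_div_iff hs1, Iinf_stripYT_eq_tsum_LMM hT, stripLenI, ← hsM.tsum_sub hMs, ← tsum_mul_right]
  refine tsum_congr fun n => ?_
  change M n * (∑ k ∈ range n, s ^ k) * (1 - s) = M n - M n * s ^ n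
  rw [mul_assoc, geom_sum_mul_neg, mul_sub, mul_one]

/-- ★★ **The mean-contact matrix is the endpoint slope of the contact family**: for all levels `a, b` (`T ≥ 2`),
`((Iinf T y_T)_{ab} − I(y)_{ab})/(y_T − y) ⟶ Σ_j j · m_{ab}(j) · y_T^{j−1}` as `y ↑ y_T`,
where `m_{ab}(j) = irCoeff T j a b` is the `x_c^{length}`-weight of the irreducible standard horizontal bridges `a → b` with `j` surface
contacts: the left derivative of the contact generating matrix at `y_T` is the first moment of the number of contacts (finite by the
tree's `exists_tsum_mul_irCoeff_mul_pow_le`; dominated convergence of `(y_T^j − y^j)/(y_T − y) ↑ j y_T^{j−1}`).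
[cite: Seneta1973, §6.2 Theorem 6.3; Feller1968, XIII.11; DuminilCopinHammond2013, §2.2; BeatonBousquetMelouDeGierDuminilCopinGuttmann2014, Corollary 8 (arXiv v5 p. 12: the threshold y_T); lane «pcv-sawmu» a-p2 g23 — own] -/
theorem tendsto_slope_Iinf (hT : 2 ≤ T) (a b : Fin (2 * T)) :
    Tendsto (fun y => (Iinf T (stripYT T) a b - Iinf T y a b) / (stripYT T - y)) (𝓝[<] stripYT T)
      (𝓝 (∑' j : ℕ, (j : ℝ) * irCoeff T j a b * stripYT T ^ (j - 1))) := by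
  have hT1 : 1 ≤ T := by omega
  have hyT := one_lt_stripYT hT1
  have hy : 0 ≤ stripYT T := (stripYT_pos hT1).le
  set m : ℕ → ℝ := fun j => irCoeff T j a b with hm
  have hm0 : ∀ j : ℕ, 0 ≤ m j := fun j => irCoeff_nonneg hT1 j a b
  obtain ⟨K, hK⟩ := exists_tsum_mul_irCoeff_mul_pow_le hT
  have hsjm : Summable fun j : ℕ => (j : ℝ) * m j * stripYT T ^ (j - 1) := (hK a b).1
  have hsT : Summable fun j : ℕ => m j * stripYT T ^ j := summable_irCoeff_mul_pow_stripYT hT a b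
  -- the two-variable geometric sums `Σ_{i<j} y_T^i y^{j-1-i} ≤ j y_T^{j-1}` for `0 ≤ y ≤ y_T`
  have hgeom_le : ∀ y ∈ Set.Ico (1 : ℝ) (stripYT T), ∀ j : ℕ,
      ∑ i ∈ range j, stripYT T ^ i * y ^ (j - 1 - i) ≤ j * stripYT T ^ (j - 1) := fun y hy' j => by
    have hy0 : 0 ≤ y := zero_le_one.trans hy'.1
    calc ∑ i ∈ range j, stripYT T ^ i * y ^ (j - 1 - i) ≤ ∑ _i ∈ range j, stripYT T ^ (j - 1) := by
          refine sum_le_sum fun i hi => ?_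
          rw [Finset.mem_range] at hi
          calc stripYT T ^ i * y ^ (j - 1 - i) ≤ stripYT T ^ i * stripYT T ^ (j - 1 - i) :=
                mul_le_mul_of_nonneg_left (pow_le_pow_left₀ hy0 hy'.2.le _) (pow_nonneg hy _)
            _ = stripYT T ^ (j - 1) := by rw [← pow_add]; congr 1; omega
      _ = j * stripYT T ^ (j - 1) := by simp
  have hlim : Tendsto (fun y : ℝ => ∑' j : ℕ, m j * ∑ i ∈ range j, stripYT T ^ i * y ^ (j - 1 - i)) (𝓝[<] stripYT T)
      (𝓝 (∑' j : ℕ, (j : ℝ) * m j * stripYT T ^ (j - 1))) := by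
    have h := tendsto_tsum_of_dominated_convergence (𝓕 := 𝓝[<] stripYT T)
      (f := fun (y : ℝ) (j : ℕ) => m j * ∑ i ∈ range j, stripYT T ^ i * y ^ (j - 1 - i))
      (g := fun j : ℕ => (j : ℝ) * m j * stripYT T ^ (j - 1))
      (bound := fun j : ℕ => (j : ℝ) * m j * stripYT T ^ (j - 1)) hsjm
      (fun j => by
        have hc : Continuous fun y : ℝ => m j * ∑ i ∈ range j, stripYT T ^ i * y ^ (j - 1 - i) :=
          continuous_const.mul (continuous_finsetSum _ fun i _ => continuous_const.mul (continuous_pow _))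
        have := hc.tendsto (stripYT T)
        have hval : m j * ∑ i ∈ range j, stripYT T ^ i * stripYT T ^ (j - 1 - i) = (j : ℝ) * m j * stripYT T ^ (j - 1) := by
          have : ∑ i ∈ range j, stripYT T ^ i * stripYT T ^ (j - 1 - i) = j * stripYT T ^ (j - 1) := by
            calc ∑ i ∈ range j, stripYT T ^ i * stripYT T ^ (j - 1 - i) = ∑ _i ∈ range j, stripYT T ^ (j - 1) := by
                  refine sum_congr rfl fun i hi => ?_
                  rw [Finset.mem_range] at hi
                  rw [← pow_add]; congr 1; omega
              _ = j * stripYT T ^ (j - 1) := by simp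
          rw [this]; ring
        rw [hval] at this
        exact this.mono_left nhdsWithin_le_nhds)
      (by
        filter_upwards [Ico_mem_nhdsLT hyT] with y hy' j
        have hy0 : 0 ≤ y := zero_le_one.trans hy'.1
        rw [Real.norm_eq_abs, abs_of_nonneg (mul_nonneg (hm0 j)
          (sum_nonneg fun i _ => mul_nonneg (pow_nonneg hy _) (pow_nonneg hy0 _)))]
        calc m j * ∑ i ∈ range j, stripYT T ^ i * y ^ (j - 1 - i) ≤ m j * (j * stripYT T ^ (j - 1)) :=
              mul_le_mul_of_nonneg_left (hgeom_le y hy' j) (hm0 j)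
          _ = (j : ℝ) * m j * stripYT T ^ (j - 1) := by ring)
    exact h
  refine hlim.congr' ?_
  filter_upwards [Ico_mem_nhdsLT hyT] with y hy'
  have hne : stripYT T - y ≠ 0 := sub_ne_zero.2 (ne_of_gt hy'.2)
  have hsy : Summable fun j : ℕ => m j * y ^ j := summable_irCoeff_mul_pow hT1 hy' a b
  rw [eq_div_iff hne, ← (tendsto_Iinf_stripYT hT a b).2, Iinf_eq_tsum_irCoeff hT1 hy', ← hsT.tsum_sub hsy, ← tsum_mul_right]
  refine tsum_congr fun j => ?_
  change m j * (∑ i ∈ range j, stripYT T ^ i * y ^ (j - 1 - i)) * (stripYT T - y) = m j * stripYT T ^ j - m j * y ^ j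
  rw [mul_assoc, geom_sum₂_mul, mul_sub]

end Moments

/-! ### §3 Renewal identities in the limit: the residue has right-fixed columns, and `ℓ (J · Res) = ℓ` (generic, no spectral theory) -/

section Generic

variable {ι : Type*} [Fintype ι] {I D : ℝ → Matrix ι ι ℝ} {R₀ : ℝ} {Icrit Res J : Matrix ι ι ℝ}

/-- **The residue of a matrix renewal family has right-fixed columns.**  If `D(t) = I(t) + I(t)·D(t)` near the left of `R₀`,
`I(t) → I₀` and `(R₀ − t)·D(t) → Res` entrywise as `t ↑ R₀`, then `I₀ · Res = Res` (multiply the renewal equation by `R₀ − t`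
and pass to the limit).  Generic plumbing for both fugacities of the strip. [cite: Feller1968, XIII.3 (the renewal equation U = F + F ∗ U); Seneta1973, §6.2; lane plumbing a-p2 g23] -/
theorem mul_residue_eq_of_renewal
    (hren : ∀ᶠ t in 𝓝[<] R₀, ∀ a b, D t a b = I t a b + ∑ c, I t a c * D t c b)
    (hI : ∀ a b, Tendsto (fun t => I t a b) (𝓝[<] R₀) (𝓝 (Icrit a b)))
    (hD : ∀ a b, Tendsto (fun t => (R₀ - t) * D t a b) (𝓝[<] R₀) (𝓝 (Res a b))) :
    Icrit * Res = Res := by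
  ext a b
  rw [Matrix.mul_apply]
  have h0 : Tendsto (fun t : ℝ => R₀ - t) (𝓝[<] R₀) (𝓝 0) := by
    have : Tendsto (fun t : ℝ => R₀ - t) (𝓝 R₀) (𝓝 (R₀ - R₀)) := tendsto_const_nhds.sub tendsto_id
    rw [sub_self] at this
    exact this.mono_left nhdsWithin_le_nhds
  -- the right-hand side of `(R₀ − t) D = (R₀ − t) I + Σ_c I_{ac} ((R₀ − t) D_{cb})` converges to `0 + Σ_c I₀_{ac} Res_{cb}`
  have hR : Tendsto (fun t => (R₀ - t) * I t a b + ∑ c, I t a c * ((R₀ - t) * D t c b)) (𝓝[<] R₀)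
      (𝓝 (0 * Icrit a b + ∑ c, Icrit a c * Res c b)) :=
    (h0.mul (hI a b)).add (tendsto_finsetSum _ fun c _ => (hI a c).mul (hD c b))
  rw [zero_mul, zero_add] at hR
  refine tendsto_nhds_unique (hR.congr' ?_) (hD a b)
  filter_upwards [hren] with t ht
  rw [ht a b, mul_add, mul_sum]
  refine congrArg _ (sum_congr rfl fun c _ => by ring)

/-- **The first-order identity `ℓ · (J · Res) = ℓ`.**  If moreover `(I₀ − I(t))/(R₀ − t) → J` entrywise and `ℓ` is a LEFT fixed
vector of `I₀` (`ℓ I₀ = ℓ`), then `ℓ (J Res) = ℓ`: multiply the renewal equation on the left by `ℓ`, use `ℓ(1 − I(t)) = ℓ(I₀ − I(t))`,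
divide by `R₀ − t` and pass to the limit.  This is the normalisation that turns «the residue has rank one» into «the renewal
constant is one over the mean». [cite: Feller1968, XIII.11 (the renewal constant 1/μ); Seneta1973, §6.2 Theorem 6.3; Giacomin2011, Ch. 2 (2.9)–(2.11) (one-type case: F′(h) = 1/E τ̃); lane plumbing a-p2 g23] -/
theorem vecMul_slope_mul_residue_eq_of_renewal {ℓ : ι → ℝ}
    (hren : ∀ᶠ t in 𝓝[<] R₀, ∀ a b, D t a b = I t a b + ∑ c, I t a c * D t c b)
    (hI : ∀ a b, Tendsto (fun t => I t a b) (𝓝[<] R₀) (𝓝 (Icrit a b)))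
    (hD : ∀ a b, Tendsto (fun t => (R₀ - t) * D t a b) (𝓝[<] R₀) (𝓝 (Res a b)))
    (hJ : ∀ a b, Tendsto (fun t => (Icrit a b - I t a b) / (R₀ - t)) (𝓝[<] R₀) (𝓝 (J a b)))
    (hℓ : ℓ ᵥ* Icrit = ℓ) : ℓ ᵥ* (J * Res) = ℓ := by
  funext b
  have hℓb : ∀ d, ∑ c, ℓ c * Icrit c d = ℓ d := fun d => by
    have := congr_fun hℓ d
    simpa [Matrix.vecMul, dotProduct] using this
  -- `G(t) := Σ_d (Σ_c ℓ_c (I₀ − I(t))_{cd}/(R₀ − t)) · ((R₀ − t) D(t)_{db})` tends to `(ℓ (J Res))_b` …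
  have hG : Tendsto (fun t => ∑ d, (∑ c, ℓ c * ((Icrit c d - I t c d) / (R₀ - t))) * ((R₀ - t) * D t d b)) (𝓝[<] R₀)
      (𝓝 (∑ d, (∑ c, ℓ c * J c d) * Res d b)) :=
    tendsto_finsetSum _ fun d _ => (tendsto_finsetSum _ fun c _ => (hJ c d).const_mul _).mul (hD d b)
  -- … and equals `Σ_c ℓ_c I(t)_{cb}`, which tends to `Σ_c ℓ_c I₀_{cb} = ℓ_b`
  have hF : Tendsto (fun t => ∑ c, ℓ c * I t c b) (𝓝[<] R₀) (𝓝 (∑ c, ℓ c * Icrit c b)) :=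
    tendsto_finsetSum _ fun c _ => (hI c b).const_mul _
  rw [hℓb] at hF
  have heq : ∀ᶠ t in 𝓝[<] R₀,
      ∑ d, (∑ c, ℓ c * ((Icrit c d - I t c d) / (R₀ - t))) * ((R₀ - t) * D t d b) = ∑ c, ℓ c * I t c b := by
    filter_upwards [hren, self_mem_nhdsWithin] with t ht hlt
    have hne : R₀ - t ≠ 0 := sub_ne_zero.2 (ne_of_gt hlt)
    -- remove the `(R₀ − t)` factors
    have h1 : ∀ d, (∑ c, ℓ c * ((Icrit c d - I t c d) / (R₀ - t))) * ((R₀ - t) * D t d b) =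
        (∑ c, ℓ c * (Icrit c d - I t c d)) * D t d b := fun d => by
      have hs : ∑ c, ℓ c * ((Icrit c d - I t c d) / (R₀ - t)) = (∑ c, ℓ c * (Icrit c d - I t c d)) * (R₀ - t)⁻¹ := by
        simp only [div_eq_mul_inv, sum_mul]
        exact sum_congr rfl fun c _ => by ring
      rw [hs, mul_assoc, ← mul_assoc (R₀ - t)⁻¹, inv_mul_cancel₀ hne, one_mul]
    simp_rw [h1, mul_sub, sum_sub_distrib, hℓb, sub_mul, sum_sub_distrib]
    -- `Σ_d ℓ_d D_{db} − Σ_d (Σ_c ℓ_c I_{cd}) D_{db} = Σ_c ℓ_c I_{cb}` from the renewal equation summed against `ℓ`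
    have h2 : ∑ d, ℓ d * D t d b = ∑ c, ℓ c * I t c b + ∑ d, (∑ c, ℓ c * I t c d) * D t d b := by
      calc ∑ d, ℓ d * D t d b = ∑ d, (ℓ d * I t d b + ∑ c, ℓ d * (I t d c * D t c b)) := by
            refine sum_congr rfl fun d _ => ?_
            rw [ht d b, mul_add, mul_sum]
        _ = ∑ c, ℓ c * I t c b + ∑ d, ∑ c, ℓ d * (I t d c * D t c b) := sum_add_distrib
        _ = ∑ c, ℓ c * I t c b + ∑ c, ∑ d, ℓ d * (I t d c * D t c b) := by rw [sum_comm]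
        _ = ∑ c, ℓ c * I t c b + ∑ d, (∑ c, ℓ c * I t c d) * D t d b := by
            congr 1
            refine sum_congr rfl fun c _ => ?_
            rw [sum_mul]
            exact sum_congr rfl fun d _ => by ring
    linarith
  have hG' := hG.congr' heq
  have key := tendsto_nhds_unique hG' hF
  have lhs : (ℓ ᵥ* (J * Res)) b = ∑ d, (∑ c, ℓ c * J c d) * Res d b := by
    simp only [Matrix.vecMul, dotProduct, Matrix.mul_apply, mul_sum, sum_mul]
    rw [sum_comm]
    exact sum_congr rfl fun d _ => sum_congr rfl fun c _ => by ring
  rw [lhs]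
  exact key

/-- ★★ **Explicit residue from the fixed vectors and the slope** (generic; NO spectral theory): under the hypotheses of the two lemmas
above, if the limit kernel `I₀ ≥ 0` is irreducible with a POSITIVE right fixed vector `u` (`I₀ u = u`) and `ℓ` is a left fixed
vector with some non-zero entry, then `ℓ · J u ≠ 0` and for all `a, b`
`Res_{ab} = u_a ℓ_b / (ℓ · J u)` —
every column of `Res` is right-fixed hence a multiple `t_b u` of `u` (the tree's minimum-ratio lemma
`exists_eq_smul_of_mulVec_eq`), and `ℓ (J Res) = ℓ` pins `t_b = ℓ_b/(ℓ · J u)`.  The Markov-renewal formula «residue = (right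
vector ⊗ left vector)/(left vector · mean matrix · right vector)». [cite: Seneta1973, §6.2 Theorem 6.3 and §1.4; Feller1968, XIII.11; Giacomin2011, Ch. 2 (2.11); lane «pcv-sawmu» a-p2 g23 — own packaging] -/
theorem residue_eq_of_renewal [DecidableEq ι] [Nonempty ι] {u ℓ : ι → ℝ}
    (hren : ∀ᶠ t in 𝓝[<] R₀, ∀ a b, D t a b = I t a b + ∑ c, I t a c * D t c b)
    (hI : ∀ a b, Tendsto (fun t => I t a b) (𝓝[<] R₀) (𝓝 (Icrit a b)))
    (hD : ∀ a b, Tendsto (fun t => (R₀ - t) * D t a b) (𝓝[<] R₀) (𝓝 (Res a b)))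
    (hJ : ∀ a b, Tendsto (fun t => (Icrit a b - I t a b) / (R₀ - t)) (𝓝[<] R₀) (𝓝 (J a b)))
    (hnn : ∀ a b, 0 ≤ Icrit a b) (hirr : ∀ a b, ∃ j : ℕ, 0 < (Icrit ^ j) a b)
    (hu0 : ∀ a, 0 < u a) (hu : Icrit *ᵥ u = u) (hℓ : ℓ ᵥ* Icrit = ℓ) (hℓ0 : ∃ b, ℓ b ≠ 0) :
    ℓ ⬝ᵥ (J *ᵥ u) ≠ 0 ∧ ∀ a b, Res a b = u a * ℓ b / (ℓ ⬝ᵥ (J *ᵥ u)) := by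
  have hfix := mul_residue_eq_of_renewal hren hI hD
  have hnorm := vecMul_slope_mul_residue_eq_of_renewal hren hI hD hJ hℓ
  -- each column of `Res` is a multiple of `u`
  have hcol : ∀ b, ∃ t : ℝ, (fun a => Res a b) = t • u := fun b =>
    exists_eq_smul_of_mulVec_eq hnn hirr hu0 hu (w := fun a => Res a b) (by
      funext a
      have := congr_fun (congr_fun hfix a) b
      rw [Matrix.mul_apply] at this
      simpa [Matrix.mulVec, dotProduct] using this)
  choose t ht using hcol
  have hRes : ∀ a b, Res a b = t b * u a := fun a b => by
    have := congr_fun (ht b) a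
    simpa using this
  -- `t_b · (ℓ · J u) = ℓ_b`
  have ht_eq : ∀ b, t b * (ℓ ⬝ᵥ (J *ᵥ u)) = ℓ b := fun b => by
    have := congr_fun hnorm b
    simp only [Matrix.vecMul, dotProduct, Matrix.mul_apply, Matrix.mulVec, hRes] at this ⊢
    rw [← this]
    simp only [mul_sum]
    exact sum_congr rfl fun c _ => sum_congr rfl fun d _ => by ring
  obtain ⟨b₀, hb₀⟩ := hℓ0
  have hne : ℓ ⬝ᵥ (J *ᵥ u) ≠ 0 := fun h => hb₀ (by rw [← ht_eq b₀, h, mul_zero])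
  refine ⟨hne, fun a b => ?_⟩
  rw [hRes, eq_div_iff hne, mul_comm (t b) (u a), mul_assoc, ht_eq]

end Generic

/-! ### §4 The strip: positive fixed vectors of the critical kernel, and the two residues made explicit -/

section Strip

/-- ★ **Positive fixed vectors of the critical kernel exist** (`T ≥ 2`): there are entrywise positive `u` (right: `I_T u = u`) and `ℓ`
(left: `ℓ I_T = ℓ`) for `I_T = Iinf T y_T` — the entrance law and the exit law of the critical bridges (from the tree's residue theorem,
whose limit kernel is identified with `Iinf T y_T` by §1).  By irreducibility each is unique up to a positive factor
(`exists_eq_smul_of_mulVec_eq`), and every statement below is invariant under such rescalings.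
[cite: Seneta1973, §1.4 and §6.2 Theorem 6.3; DuminilCopinHammond2013, §2.2; lane «pcv-sawmu» a-p2 g23] -/
theorem exists_pos_fixed_vectors_Iinf_stripYT (hT : 2 ≤ T) :
    ∃ u ℓ : Fin (2 * T) → ℝ, (∀ a, 0 < u a) ∧ (∀ b, 0 < ℓ b) ∧
      Iinf T (stripYT T) *ᵥ u = u ∧ ℓ ᵥ* Iinf T (stripYT T) = ℓ := by
  obtain ⟨IT, u, ℓ, -, hI, hu0, hℓ0, hu, hℓ, -, -⟩ := exists_tendsto_hKernel_residue hT
  have hIT : IT = Iinf T (stripYT T) := by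
    ext a b
    exact tendsto_nhds_unique (hI a b) (tendsto_Iinf_stripYT hT a b).1
  exact ⟨u, ℓ, hu0, hℓ0, hIT ▸ hu, hIT ▸ hℓ⟩

variable {u ℓ : Fin (2 * T) → ℝ}

/-- ★★★ **THE CONTACT RESIDUE MADE EXPLICIT** (`T ≥ 2`).  For ANY positive right fixed vector `u` and left fixed vector `ℓ` of the
critical kernel `Iinf T y_T`, the mean-contact pairing is positive, `⟨ℓ, M̄_top u⟩ := Σ_{a,b} ℓ_a (Σ_j j m_{ab}(j) y_T^{j−1}) u_b > 0`,
and for all levels `a, b`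
`(y_T − y) · D_{ab}(y) ⟶ u_a ℓ_b / ⟨ℓ, M̄_top u⟩` as `y ↑ y_T`,
`D_{ab}(y) = hKernel T a b y` the generating function of the standard horizontal bridges `a → b` at `x = x_c`.  The tree's
`exists_tendsto_hKernel_residue` gives the rank-one residue `ρ u_a ℓ_b` with an unidentified `ρ`; here `ρ = 1/⟨ℓ, M̄_top u⟩` — the
Markov-renewal constant «one over the mean number of contacts of an irreducible bridge under the invariant weighting
`π(ω) ∝ ℓ_{start} x_c^{|ω|} y_T^{#top} u_{end}`» (up to the factor `y_T` of the grading).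
[cite: Feller1968, XIII.11 (renewal constant 1/μ); Seneta1973, §6.2 Theorem 6.3; Giacomin2011, Ch. 2 (2.9)–(2.11); DuminilCopinHammond2013, §2.2; BeatonBousquetMelouDeGierDuminilCopinGuttmann2014, Corollary 8 (arXiv v5 p. 12); lane «pcv-sawmu» a-p2 g23 — own result] -/
theorem tendsto_hKernel_residue_explicit (hT : 2 ≤ T) (hu0 : ∀ a, 0 < u a) (hℓ0 : ∀ b, 0 < ℓ b)
    (hu : Iinf T (stripYT T) *ᵥ u = u) (hℓ : ℓ ᵥ* Iinf T (stripYT T) = ℓ) :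
    0 < ℓ ⬝ᵥ ((Matrix.of fun a b : Fin (2 * T) => ∑' j : ℕ, (j : ℝ) * irCoeff T j a b * stripYT T ^ (j - 1)) *ᵥ u) ∧
      ∀ a b : Fin (2 * T), Tendsto (fun y => (stripYT T - y) * hKernel T a b y) (𝓝[<] stripYT T)
        (𝓝 (u a * ℓ b /
          (ℓ ⬝ᵥ ((Matrix.of fun a b : Fin (2 * T) => ∑' j : ℕ, (j : ℝ) * irCoeff T j a b * stripYT T ^ (j - 1)) *ᵥ u)))) := by
  have hT1 : 1 ≤ T := by omega
  haveI : Nonempty (Fin (2 * T)) := ⟨⟨0, by omega⟩⟩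
  set Mc : Matrix (Fin (2 * T)) (Fin (2 * T)) ℝ :=
    Matrix.of fun a b : Fin (2 * T) => ∑' j : ℕ, (j : ℝ) * irCoeff T j a b * stripYT T ^ (j - 1) with hMc
  obtain ⟨-, u₀, ℓ₀, ρ₀, -, hu₀, hℓ₀, -, -, hρ₀, hres⟩ := exists_tendsto_hKernel_residue hT
  set Res : Matrix (Fin (2 * T)) (Fin (2 * T)) ℝ := Matrix.of fun a b => ρ₀ * (u₀ a * ℓ₀ b) with hRes
  have hD : ∀ a b, Tendsto (fun y => (stripYT T - y) * hKernel T a b y) (𝓝[<] stripYT T) (𝓝 (Res a b)) := fun a b => by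
    rw [hRes, Matrix.of_apply]; exact hres a b
  have hren : ∀ᶠ y in 𝓝[<] stripYT T, ∀ a b : Fin (2 * T), hKernel T a b y = Iinf T y a b + ∑ c, Iinf T y a c * hKernel T c b y := by
    filter_upwards [Ico_mem_nhdsLT (one_lt_stripYT hT1)] with y hy a b using hKernel_eq_Iinf_add_sum_mul hT1 hy a b
  obtain ⟨hnn, hirr⟩ := Iinf_stripYT_nonneg_irred hT
  obtain ⟨hne, hexpl⟩ := residue_eq_of_renewal (I := fun y => Iinf T y) (D := fun y => Matrix.of fun a b => hKernel T a b y)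
    (R₀ := stripYT T) (Icrit := Iinf T (stripYT T)) (Res := Res) (J := Mc) (u := u) (ℓ := ℓ)
    (by simpa only [Matrix.of_apply] using hren) (fun a b => (tendsto_Iinf_stripYT hT a b).1)
    (fun a b => by simpa only [Matrix.of_apply] using hD a b)
    (fun a b => by rw [hMc, Matrix.of_apply]; exact tendsto_slope_Iinf hT a b) hnn hirr hu0 hu hℓ ⟨⟨0, by omega⟩, (hℓ0 _).ne'⟩
  have hpos : 0 < ℓ ⬝ᵥ (Mc *ᵥ u) := by
    have h1 : 0 < Res ⟨0, by omega⟩ ⟨0, by omega⟩ := by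
      rw [hRes, Matrix.of_apply]; exact mul_pos hρ₀ (mul_pos (hu₀ _) (hℓ₀ _))
    rw [hexpl] at h1
    exact (div_pos_iff_of_pos_left (mul_pos (hu0 _) (hℓ0 _))).1 h1
  exact ⟨hpos, fun a b => by rw [← hexpl a b]; exact hD a b⟩

/-- ★★★ **THE LENGTH RESIDUE MADE EXPLICIT** (`T ≥ 2`).  For the SAME `u`, `ℓ` (any positive right / left fixed vectors of
`Iinf T y_T`), the mean-length pairing is positive, `⟨ℓ, M̄_len u⟩ := Σ_{a,b} ℓ_a (Σ_n n M(n)_{ab}) u_b > 0`, and for all levels `a, b`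
`(1 − s) · D_T(s)_{ab} ⟶ u_a ℓ_b / ⟨ℓ, M̄_len u⟩` as `s ↑ 1`,
`D_T(s)_{ab} = stripLenD T s a b = Σ_n D(n)_{ab} s^n` the length generating function of the standard horizontal bridges `a → b` at `y = y_T`
(`s = x/x_c`).  The tree's `exists_tendsto_stripLenD_residue` gives `ρ′ u′_a ℓ′_b` with unidentified data; here `u′ ∝ u`, `ℓ′ ∝ ℓ` are
the contact family's vectors and `ρ′ = 1/⟨ℓ, M̄_len u⟩` — one over the mean number of STEPS of an irreducible bridge under the same
invariant weighting. [cite: Feller1968, XIII.11; Seneta1973, §6.2 Theorem 6.3; Giacomin2011, Ch. 2 (2.11); DuminilCopinHammond2013, §2.2; BeatonBousquetMelouDeGierDuminilCopinGuttmann2014, Corollary 8 (arXiv v5 p. 12: ρ_T(y_T) = x_c); lane «pcv-sawmu» a-p2 g23 — own result] -/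
theorem tendsto_stripLenD_residue_explicit (hT : 2 ≤ T) (hu0 : ∀ a, 0 < u a) (hℓ0 : ∀ b, 0 < ℓ b)
    (hu : Iinf T (stripYT T) *ᵥ u = u) (hℓ : ℓ ᵥ* Iinf T (stripYT T) = ℓ) :
    0 < ℓ ⬝ᵥ ((Matrix.of fun a b : Fin (2 * T) => ∑' n : ℕ, (n : ℝ) * LMM T n (n : ℤ) (stripYT T) a b) *ᵥ u) ∧
      ∀ a b : Fin (2 * T), Tendsto (fun s => (1 - s) * stripLenD T s a b) (𝓝[<] 1)
        (𝓝 (u a * ℓ b / (ℓ ⬝ᵥ ((Matrix.of fun a b : Fin (2 * T) => ∑' n : ℕ, (n : ℝ) * LMM T n (n : ℤ) (stripYT T) a b) *ᵥ u)))) := by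
  have hT1 : 1 ≤ T := by omega
  haveI : Nonempty (Fin (2 * T)) := ⟨⟨0, by omega⟩⟩
  set Ml : Matrix (Fin (2 * T)) (Fin (2 * T)) ℝ :=
    Matrix.of fun a b : Fin (2 * T) => ∑' n : ℕ, (n : ℝ) * LMM T n (n : ℤ) (stripYT T) a b with hMl
  obtain ⟨u₀, ℓ₀, ρ₀, hu₀, hℓ₀, hρ₀, hres⟩ := exists_tendsto_stripLenD_residue hT
  set Res : Matrix (Fin (2 * T)) (Fin (2 * T)) ℝ := Matrix.of fun a b => ρ₀ * (u₀ a * ℓ₀ b) with hRes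
  have hD : ∀ a b, Tendsto (fun s => (1 - s) * stripLenD T s a b) (𝓝[<] 1) (𝓝 (Res a b)) := fun a b => by
    rw [hRes, Matrix.of_apply]; exact hres a b
  have hren : ∀ᶠ s in 𝓝[<] (1 : ℝ), ∀ a b : Fin (2 * T), stripLenD T s a b = stripLenI T s a b + ∑ c, stripLenI T s a c * stripLenD T s c b := by
    filter_upwards [Ico_mem_nhdsLT zero_lt_one] with s hs a b
    have h := congr_fun (congr_fun (stripLenD_eq_stripLenI_add_mul hT1 hs.1 hs.2 (T := T)) a) b
    rwa [Matrix.add_apply, Matrix.mul_apply] at h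
  obtain ⟨hnn, hirr⟩ := Iinf_stripYT_nonneg_irred hT
  obtain ⟨hne, hexpl⟩ := residue_eq_of_renewal (I := fun s => stripLenI T s) (D := fun s => stripLenD T s)
    (R₀ := 1) (Icrit := Iinf T (stripYT T)) (Res := Res) (J := Ml) (u := u) (ℓ := ℓ)
    hren (fun a b => tendsto_stripLenI_one hT a b) hD
    (fun a b => by rw [hMl, Matrix.of_apply]; exact tendsto_slope_stripLenI hT a b) hnn hirr hu0 hu hℓ ⟨⟨0, by omega⟩, (hℓ0 _).ne'⟩
  have hpos : 0 < ℓ ⬝ᵥ (Ml *ᵥ u) := by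
    have h1 : 0 < Res ⟨0, by omega⟩ ⟨0, by omega⟩ := by
      rw [hRes, Matrix.of_apply]; exact mul_pos hρ₀ (mul_pos (hu₀ _) (hℓ₀ _))
    rw [hexpl] at h1
    exact (div_pos_iff_of_pos_left (mul_pos (hu0 _) (hℓ0 _))).1 h1
  exact ⟨hpos, fun a b => by rw [← hexpl a b]; exact hD a b⟩

/-- ★★★ **THE TWO RESIDUES ARE PROPORTIONAL, WITH A LEVEL-INDEPENDENT FACTOR** (`T ≥ 2`): for all levels `a, b`,
`[lim_{s↑1} (1 − s) D_T(s)_{ab}] · ⟨ℓ, M̄_len u⟩ = u_a ℓ_b = [lim_{y↑y_T} (y_T − y) D_{ab}(y)] · ⟨ℓ, M̄_top u⟩` —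
the singular parts of the bridge generating functions in the length fugacity (`x ↑ x_c` at `y = y_T`) and in the contact fugacity
(`y ↑ y_T` at `x = x_c`) are the SAME rank-one matrix up to the scalar `κ_T = ⟨ℓ, M̄_top u⟩/⟨ℓ, M̄_len u⟩` (mean contacts per step,
divided by `y_T`), whatever the entrance and exit levels.  Stated for any pair of limits `Rl`, `Rc`.
[cite: Seneta1973, §6.2; Feller1968, XIII.11; DuminilCopinHammond2013, §2.2; lane «pcv-sawmu» a-p2 g23 — own result] -/
theorem lenResidue_mul_eq_contactResidue_mul (hT : 2 ≤ T) (hu0 : ∀ a, 0 < u a) (hℓ0 : ∀ b, 0 < ℓ b)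
    (hu : Iinf T (stripYT T) *ᵥ u = u) (hℓ : ℓ ᵥ* Iinf T (stripYT T) = ℓ) (a b : Fin (2 * T)) {Rl Rc : ℝ}
    (hRl : Tendsto (fun s => (1 - s) * stripLenD T s a b) (𝓝[<] 1) (𝓝 Rl))
    (hRc : Tendsto (fun y => (stripYT T - y) * hKernel T a b y) (𝓝[<] stripYT T) (𝓝 Rc)) :
    Rl * (ℓ ⬝ᵥ ((Matrix.of fun a b : Fin (2 * T) => ∑' n : ℕ, (n : ℝ) * LMM T n (n : ℤ) (stripYT T) a b) *ᵥ u)) = u a * ℓ b ∧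
      Rc * (ℓ ⬝ᵥ ((Matrix.of fun a b : Fin (2 * T) => ∑' j : ℕ, (j : ℝ) * irCoeff T j a b * stripYT T ^ (j - 1)) *ᵥ u)) =
        u a * ℓ b := by
  obtain ⟨hl, hL⟩ := tendsto_stripLenD_residue_explicit hT hu0 hℓ0 hu hℓ
  obtain ⟨hc, hC⟩ := tendsto_hKernel_residue_explicit hT hu0 hℓ0 hu hℓ
  refine ⟨?_, ?_⟩
  · rw [tendsto_nhds_unique hRl (hL a b), div_mul_cancel₀ _ hl.ne']
  · rw [tendsto_nhds_unique hRc (hC a b), div_mul_cancel₀ _ hc.ne']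

end Strip

/-! ### §5 The amplitudes of the bridges and of the β-walks in both gradings, and the headline ratio -/

section Amplitudes

variable {u ℓ : Fin (2 * T) → ℝ}

/-- ★★ **The bridge amplitudes in both gradings, explicitly** (`T ≥ 2`): for all levels `a, b`,
`d_{ab}(m) · y_T^m ⟶ u_a ℓ_b / (y_T ⟨ℓ, M̄_top u⟩)` (bridges with `m` surface contacts) and
`D(2k + χ_a − χ_b)_{ab} ⟶ 2 u_a ℓ_b / ⟨ℓ, M̄_len u⟩` (bridges with exactly that many steps; factor `2` = the period of the length
grading) — the tree's pointwise laws `exists_tendsto_hbCoeff_mul_pow` / `exists_tendsto_LUM_parity` with their constants identified.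
[cite: Feller1968, XIII.3, XIII.11; DuminilCopinHammond2013, §2.2; lane «pcv-sawmu» a-p2 g23 — own result] -/
theorem bridge_amplitudes_explicit (hT : 2 ≤ T) (hu0 : ∀ a, 0 < u a) (hℓ0 : ∀ b, 0 < ℓ b)
    (hu : Iinf T (stripYT T) *ᵥ u = u) (hℓ : ℓ ᵥ* Iinf T (stripYT T) = ℓ) (a b : Fin (2 * T)) :
    Tendsto (fun m : ℕ => hbCoeff T m a b * stripYT T ^ m) atTop
        (𝓝 (u a * ℓ b / (ℓ ⬝ᵥ ((Matrix.of fun a b : Fin (2 * T) => ∑' j : ℕ, (j : ℝ) * irCoeff T j a b * stripYT T ^ (j - 1)) *ᵥ u)) /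
          stripYT T)) ∧
      Tendsto (fun k : ℕ => LUM T (2 * k + 1) (2 * (k : ℤ) + lchi a - lchi b) (stripYT T) a b) atTop
        (𝓝 (2 * (u a * ℓ b / (ℓ ⬝ᵥ ((Matrix.of fun a b : Fin (2 * T) => ∑' n : ℕ, (n : ℝ) * LMM T n (n : ℤ) (stripYT T) a b) *ᵥ u))))) := by
  obtain ⟨hc, hC⟩ := tendsto_hKernel_residue_explicit hT hu0 hℓ0 hu hℓ
  obtain ⟨hl, hL⟩ := tendsto_stripLenD_residue_explicit hT hu0 hℓ0 hu hℓ
  refine ⟨tendsto_hbCoeff_mul_pow_of_residue hT (fun a b => div_pos (mul_pos (hu0 a) (hℓ0 b)) hc) hC a b, ?_⟩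
  obtain ⟨u₃, ℓ₃, ρ₃, -, -, -, hres₃, hLUM₃⟩ := exists_tendsto_LUM_parity hT
  have h3 : ρ₃ * (u₃ a * ℓ₃ b) = u a * ℓ b / _ := tendsto_nhds_unique (hres₃ a b) (hL a b)
  rw [← h3]
  exact hLUM₃ a b

/-- ★★★ **THE β-WALK AMPLITUDES IN BOTH GRADINGS, EXPLICITLY** (`T ≥ 2`).  Let `Λ` be the contact amplitude (`β_{T,m} y_T^m → Λ`,
«BETA-COEFF») and `Λℓ` the length amplitude (`Σ_{β-walks with 2m vertices} x_c^{2m} y_T^{#top} → Λℓ`, «BETA-LENGTH-LAW»); let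
`F_a = headGF T a`, `G_b = tailGF T b` be the critical head and tail masses (the same in both gradings, «BETA-HEAD-TAIL-MASSES»).  Then
`Λ · y_T · ⟨ℓ, M̄_top u⟩ = 2 · (Σ_a F_a u_a)(Σ_b ℓ_b G_b)` and `Λℓ · ⟨ℓ, M̄_len u⟩ = 4 · (Σ_a F_a u_a)(Σ_b ℓ_b G_b)`:
renewal amplitude = (head mass)·(tail mass)/(mean renewal increment), with the factor `2` of the strip's mirror symmetry and, for the
length grading, the extra factor `2` of its period. [cite: Feller1968, XIII.11 (renewal with delay: amplitude = masses / mean); DuminilCopinHammond2013, §2.2; BeatonBousquetMelouDeGierDuminilCopinGuttmann2014, §3.2 and Corollary 8; lane «pcv-sawmu» a-p2 g23 — own result] -/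
theorem beta_amplitudes_explicit (hT : 2 ≤ T) (hu0 : ∀ a, 0 < u a) (hℓ0 : ∀ b, 0 < ℓ b)
    (hu : Iinf T (stripYT T) *ᵥ u = u) (hℓ : ℓ ᵥ* Iinf T (stripYT T) = ℓ) {Λ Λℓ : ℝ}
    (hΛ : Tendsto (fun m : ℕ => stripBcoeff T m * stripYT T ^ m) atTop (𝓝 Λ))
    (hΛℓ : Tendsto (fun m : ℕ => betaLenSum T (2 * m) (stripYT T)) atTop (𝓝 Λℓ)) :
    Λ * (stripYT T * (ℓ ⬝ᵥ ((Matrix.of fun a b : Fin (2 * T) => ∑' j : ℕ, (j : ℝ) * irCoeff T j a b * stripYT T ^ (j - 1)) *ᵥ u))) =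
        2 * ((∑ a : Fin (2 * T), headGF T a * u a) * (∑ b : Fin (2 * T), ℓ b * tailGF T b)) ∧
      Λℓ * (ℓ ⬝ᵥ ((Matrix.of fun a b : Fin (2 * T) => ∑' n : ℕ, (n : ℝ) * LMM T n (n : ℤ) (stripYT T) a b) *ᵥ u)) =
        4 * ((∑ a : Fin (2 * T), headGF T a * u a) * (∑ b : Fin (2 * T), ℓ b * tailGF T b)) := by
  have hT1 : 1 ≤ T := by omega
  have hyT : 0 < stripYT T := stripYT_pos hT1
  obtain ⟨hc, hC⟩ := tendsto_hKernel_residue_explicit hT hu0 hℓ0 hu hℓ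
  obtain ⟨hl, hL⟩ := tendsto_stripLenD_residue_explicit hT hu0 hℓ0 hu hℓ
  set dc := ℓ ⬝ᵥ ((Matrix.of fun a b : Fin (2 * T) => ∑' j : ℕ, (j : ℝ) * irCoeff T j a b * stripYT T ^ (j - 1)) *ᵥ u) with hdc
  set dl := ℓ ⬝ᵥ ((Matrix.of fun a b : Fin (2 * T) => ∑' n : ℕ, (n : ℝ) * LMM T n (n : ℤ) (stripYT T) a b) *ᵥ u) with hdl
  set P := (∑ a : Fin (2 * T), headGF T a * u a) * (∑ b : Fin (2 * T), ℓ b * tailGF T b) with hP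
  -- the double-sum bookkeeping, once
  have hsum : ∀ (v w : Fin (2 * T) → ℝ) (d : ℝ), (∀ a b, v a * w b = u a * ℓ b / d) →
      (∑ a : Fin (2 * T), headGF T a * v a) * (∑ b : Fin (2 * T), w b * tailGF T b) = P / d := fun v w d hvw => by
    rw [hP, sum_mul_sum, sum_mul_sum, sum_div]
    refine sum_congr rfl fun a _ => ?_
    rw [sum_div]
    refine sum_congr rfl fun b _ => ?_
    calc headGF T a * v a * (w b * tailGF T b) = headGF T a * tailGF T b * (v a * w b) := by ring
      _ = headGF T a * tailGF T b * (u a * ℓ b / d) := by rw [hvw]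
      _ = headGF T a * u a * (ℓ b * tailGF T b) / d := by ring
  refine ⟨?_, ?_⟩
  · -- contacts: identify the data of «BETA-COEFF» through the bridge law
    obtain ⟨u₁, ℓ₁, ρ₁, -, -, -, hb₁, hB₁⟩ := exists_tendsto_stripBcoeff_mul_pow hT
    have key : ∀ a b, (ρ₁ * u₁ a) * ℓ₁ b = u a * ℓ b / dc := fun a b => by
      have h1 := tendsto_hbCoeff_mul_pow_of_residue hT (fun a b => div_pos (mul_pos (hu0 a) (hℓ0 b)) hc) hC a b
      have h2 := (div_left_inj' hyT.ne').1 (tendsto_nhds_unique (hb₁ a b) h1)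
      rw [← h2]; ring
    have hρ₁ : ρ₁ ≠ 0 := by
      rintro rfl
      have := key ⟨0, by omega⟩ ⟨0, by omega⟩
      rw [zero_mul, zero_mul] at this
      exact (div_pos (mul_pos (hu0 _) (hℓ0 _)) hc).ne' this.symm
    have hΛeq := tendsto_nhds_unique hΛ hB₁
    have hS := hsum (fun a => ρ₁ * u₁ a) ℓ₁ dc key
    have hfac : (∑ a : Fin (2 * T), headGF T a * (ρ₁ * u₁ a)) = ρ₁ * ∑ a : Fin (2 * T), headGF T a * u₁ a := by
      rw [mul_sum]; exact sum_congr rfl fun a _ => by ring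
    rw [hfac, mul_assoc] at hS
    have hS' : (∑ a : Fin (2 * T), headGF T a * u₁ a) * (∑ b : Fin (2 * T), ℓ₁ b * tailGF T b) = P / dc / ρ₁ := by
      rw [eq_div_iff hρ₁, mul_comm]; exact hS
    rw [hΛeq, mul_assoc (2 * ρ₁ / stripYT T), hS']
    field_simp
  · -- lengths: identify the data of «BETA-LENGTH-LAW» through the bridge parity law and the length residue
    obtain ⟨u₂, ℓ₂, ρ₂, -, -, -, hLUM₂, hB₂⟩ := exists_tendsto_betaLenSum_even hT
    obtain ⟨u₃, ℓ₃, ρ₃, -, -, -, hres₃, hLUM₃⟩ := exists_tendsto_LUM_parity hT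
    have key : ∀ a b, (ρ₂ * u₂ a) * ℓ₂ b = u a * ℓ b / dl := fun a b => by
      have h23 : 2 * (ρ₂ * (u₂ a * ℓ₂ b)) = 2 * (ρ₃ * (u₃ a * ℓ₃ b)) := tendsto_nhds_unique (hLUM₂ a b) (hLUM₃ a b)
      have h3 : ρ₃ * (u₃ a * ℓ₃ b) = u a * ℓ b / dl := tendsto_nhds_unique (hres₃ a b) (hL a b)
      rw [← h3]; linarith
    have hρ₂ : ρ₂ ≠ 0 := by
      rintro rfl
      have := key ⟨0, by omega⟩ ⟨0, by omega⟩
      rw [zero_mul, zero_mul] at this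
      exact (div_pos (mul_pos (hu0 _) (hℓ0 _)) hl).ne' this.symm
    have hΛeq := tendsto_nhds_unique hΛℓ hB₂
    have hFG : ∀ c : Fin (2 * T), headLenGF T (c : ℕ) = headGF T c ∧ tailLenGF T (c : ℕ) = tailGF T c := fun c =>
      headLenGF_eq_headGF hT _ _
    have hS := hsum (fun a => ρ₂ * u₂ a) ℓ₂ dl key
    have hfac : (∑ a : Fin (2 * T), headGF T a * (ρ₂ * u₂ a)) = ρ₂ * ∑ a : Fin (2 * T), headGF T a * u₂ a := by
      rw [mul_sum]; exact sum_congr rfl fun a _ => by ring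
    rw [hfac, mul_assoc] at hS
    have hS' : (∑ a : Fin (2 * T), headLenGF T (a : ℕ) * u₂ a) * (∑ b : Fin (2 * T), ℓ₂ b * tailLenGF T (b : ℕ)) = P / dl / ρ₂ := by
      simp_rw [(hFG _).1, (hFG _).2]
      rw [eq_div_iff hρ₂, mul_comm]; exact hS
    rw [hΛeq, mul_assoc (4 * ρ₂), hS']
    field_simp

/-- ★★★★ **THE LENGTH AMPLITUDE AND THE CONTACT AMPLITUDE DIFFER BY THE RATIO OF THE TWO FIRST MOMENTS OF AN IRREDUCIBLE BRIDGE**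
(`T ≥ 2`): with `Λ` the contact amplitude of the β-walks (`β_{T,m} y_T^m → Λ`), `Λℓ` their length amplitude (`bℓ_T(2m)(y_T) → Λℓ`), and
`u`, `ℓ` any positive right / left fixed vectors of the critical irreducible-bridge kernel `Iinf T y_T`,
`Λℓ · ⟨ℓ, M̄_len u⟩ = 2 · Λ · (y_T ⟨ℓ, M̄_top u⟩)`, i.e. `Λℓ · ⟨steps⟩ = 2Λ · ⟨contacts⟩`
where `⟨steps⟩ = Σ_{a,b} ℓ_a u_b Σ_{ω : a → b irreducible} |ω| x_c^{|ω|} y_T^{#top(ω)}` and `⟨contacts⟩` likewise with `#top(ω)` in place of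
`|ω|`: «amplitude × mean renewal increment» is the same number in both gradings (the head and tail masses at the critical point do
not see the grading), the factor `2` being the period of the length grading.  Equivalently the conversion factor between the
`x ↑ x_c` and the `y ↑ y_T` singularities of the two-variable strip series at `(x_c, y_T)` is the mean number of surface contacts per
step of a critical irreducible bridge.  Neither amplitude is known in closed form for `T ≥ 3`; their RATIO now is a first-moment
quotient. [cite: Feller1968, XIII.11; Giacomin2011, Ch. 2 (2.9)–(2.11) (one-variable template: contact fraction = 1/mean excursion length); DuminilCopinHammond2013, §2.2; BeatonBousquetMelouDeGierDuminilCopinGuttmann2014, §3.2 and Corollary 8 (arXiv v5 p. 12); lane «pcv-sawmu» a-p2 g23 — own result] -/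
theorem lengthAmplitude_mul_meanSteps_eq (hT : 2 ≤ T) (hu0 : ∀ a, 0 < u a) (hℓ0 : ∀ b, 0 < ℓ b)
    (hu : Iinf T (stripYT T) *ᵥ u = u) (hℓ : ℓ ᵥ* Iinf T (stripYT T) = ℓ) {Λ Λℓ : ℝ}
    (hΛ : Tendsto (fun m : ℕ => stripBcoeff T m * stripYT T ^ m) atTop (𝓝 Λ))
    (hΛℓ : Tendsto (fun m : ℕ => betaLenSum T (2 * m) (stripYT T)) atTop (𝓝 Λℓ)) :
    Λℓ * (ℓ ⬝ᵥ ((Matrix.of fun a b : Fin (2 * T) => ∑' n : ℕ, (n : ℝ) * LMM T n (n : ℤ) (stripYT T) a b) *ᵥ u)) =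
      2 * Λ * (stripYT T *
        (ℓ ⬝ᵥ ((Matrix.of fun a b : Fin (2 * T) => ∑' j : ℕ, (j : ℝ) * irCoeff T j a b * stripYT T ^ (j - 1)) *ᵥ u))) := by
  obtain ⟨h1, h2⟩ := beta_amplitudes_explicit hT hu0 hℓ0 hu hℓ hΛ hΛℓ
  linear_combination h2 - 2 * h1

/-- ★★★ **UNIVERSAL RATIO** (no fixed vectors in the statement; `T ≥ 2`): for every pair of levels `a, b`, with `C_{ab} = lim_m d_{ab}(m) y_T^m`
(critical bridges `a → b` with `m` contacts) and `L_{ab} = lim_k D(2k + χ_a − χ_b)_{ab}` (critical bridges `a → b` with that many steps),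
`Λℓ · C_{ab} = Λ · L_{ab}`:
the β-walks convert between the two gradings with the SAME factor as the bridges between any two levels — one number
`κ_T` governs the passage from «many contacts» to «many steps» at the critical point of the width-`T` strip.
[cite: Feller1968, XIII.11; DuminilCopinHammond2013, §2.2; BeatonBousquetMelouDeGierDuminilCopinGuttmann2014, Corollary 8; lane «pcv-sawmu» a-p2 g23 — own result] -/
theorem lengthAmplitude_mul_bridgeContact_eq (hT : 2 ≤ T) {Λ Λℓ : ℝ}
    (hΛ : Tendsto (fun m : ℕ => stripBcoeff T m * stripYT T ^ m) atTop (𝓝 Λ))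
    (hΛℓ : Tendsto (fun m : ℕ => betaLenSum T (2 * m) (stripYT T)) atTop (𝓝 Λℓ)) (a b : Fin (2 * T)) {C L : ℝ}
    (hC : Tendsto (fun m : ℕ => hbCoeff T m a b * stripYT T ^ m) atTop (𝓝 C))
    (hL : Tendsto (fun k : ℕ => LUM T (2 * k + 1) (2 * (k : ℤ) + lchi a - lchi b) (stripYT T) a b) atTop (𝓝 L)) :
    Λℓ * C = Λ * L := by
  have hT1 : 1 ≤ T := by omega
  have hyT : 0 < stripYT T := stripYT_pos hT1
  obtain ⟨u, ℓ, hu0, hℓ0, hu, hℓ⟩ := exists_pos_fixed_vectors_Iinf_stripYT hT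
  obtain ⟨hc, -⟩ := tendsto_hKernel_residue_explicit hT hu0 hℓ0 hu hℓ
  obtain ⟨hl, -⟩ := tendsto_stripLenD_residue_explicit hT hu0 hℓ0 hu hℓ
  obtain ⟨hCt, hLt⟩ := bridge_amplitudes_explicit hT hu0 hℓ0 hu hℓ a b
  obtain ⟨h1, h2⟩ := beta_amplitudes_explicit hT hu0 hℓ0 hu hℓ hΛ hΛℓ
  have hCe := tendsto_nhds_unique hC hCt
  have hLe := tendsto_nhds_unique hL hLt
  set dc := ℓ ⬝ᵥ ((Matrix.of fun a b : Fin (2 * T) => ∑' j : ℕ, (j : ℝ) * irCoeff T j a b * stripYT T ^ (j - 1)) *ᵥ u)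
  set dl := ℓ ⬝ᵥ ((Matrix.of fun a b : Fin (2 * T) => ∑' n : ℕ, (n : ℝ) * LMM T n (n : ℤ) (stripYT T) a b) *ᵥ u)
  set P := (∑ a : Fin (2 * T), headGF T a * u a) * (∑ b : Fin (2 * T), ℓ b * tailGF T b)
  rw [hCe, hLe]
  have hΛv : Λ = 2 * P / (stripYT T * dc) := by rw [eq_div_iff (mul_pos hyT hc).ne']; exact h1
  have hΛℓv : Λℓ = 4 * P / dl := by rw [eq_div_iff hl.ne']; exact h2
  rw [hΛv, hΛℓv]
  field_simp
  ring

/-- ★★★ **Packaged headline** (`T ≥ 2`): there exist positive fixed vectors `u`, `ℓ` of the critical kernel and positive amplitudes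
`Λ` (contacts) and `Λℓ` (length) of the β-walks with `Λℓ · ⟨ℓ, M̄_len u⟩ = 2Λ · y_T ⟨ℓ, M̄_top u⟩` and both mean pairings positive (finite
by construction: the first moments of an irreducible critical bridge in steps and in contacts are finite, tree).
[cite: Feller1968, XIII.11; Giacomin2011, Ch. 2 (2.11); DuminilCopinHammond2013, §2.2; BeatonBousquetMelouDeGierDuminilCopinGuttmann2014, §3.2 and Corollary 8; lane «pcv-sawmu» a-p2 g23 — own result] -/
theorem exists_amplitude_ratio (hT : 2 ≤ T) :
    ∃ (u ℓ : Fin (2 * T) → ℝ) (Λ Λℓ : ℝ), (∀ a, 0 < u a) ∧ (∀ b, 0 < ℓ b) ∧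
      Iinf T (stripYT T) *ᵥ u = u ∧ ℓ ᵥ* Iinf T (stripYT T) = ℓ ∧ 0 < Λ ∧ 0 < Λℓ ∧
      Tendsto (fun m : ℕ => stripBcoeff T m * stripYT T ^ m) atTop (𝓝 Λ) ∧
      Tendsto (fun m : ℕ => betaLenSum T (2 * m) (stripYT T)) atTop (𝓝 Λℓ) ∧
      0 < ℓ ⬝ᵥ ((Matrix.of fun a b : Fin (2 * T) => ∑' n : ℕ, (n : ℝ) * LMM T n (n : ℤ) (stripYT T) a b) *ᵥ u) ∧
      0 < ℓ ⬝ᵥ ((Matrix.of fun a b : Fin (2 * T) => ∑' j : ℕ, (j : ℝ) * irCoeff T j a b * stripYT T ^ (j - 1)) *ᵥ u) ∧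
      Λℓ * (ℓ ⬝ᵥ ((Matrix.of fun a b : Fin (2 * T) => ∑' n : ℕ, (n : ℝ) * LMM T n (n : ℤ) (stripYT T) a b) *ᵥ u)) =
        2 * Λ * (stripYT T *
          (ℓ ⬝ᵥ ((Matrix.of fun a b : Fin (2 * T) => ∑' j : ℕ, (j : ℝ) * irCoeff T j a b * stripYT T ^ (j - 1)) *ᵥ u))) := by
  obtain ⟨u, ℓ, hu0, hℓ0, hu, hℓ⟩ := exists_pos_fixed_vectors_Iinf_stripYT hT
  obtain ⟨Λ, hΛ0, hΛ⟩ := exists_pos_tendsto_stripBcoeff_mul_pow hT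
  obtain ⟨Λℓ, hΛℓ0, hΛℓ, -⟩ := exists_pos_tendsto_betaLenSum_even hT
  exact ⟨u, ℓ, Λ, Λℓ, hu0, hℓ0, hu, hℓ, hΛ0, hΛℓ0, hΛ, hΛℓ, (tendsto_stripLenD_residue_explicit hT hu0 hℓ0 hu hℓ).1,
    (tendsto_hKernel_residue_explicit hT hu0 hℓ0 hu hℓ).1, lengthAmplitude_mul_meanSteps_eq hT hu0 hℓ0 hu hℓ hΛ hΛℓ⟩

end Amplitudes





/-! ### §6 (edition 2) The exit law and the entrance law of a long critical bridge are the SAME in both gradings -/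

section ExitLaws

variable {u ℓ : Fin (2 * T) → ℝ}

/-- ★★ **THE EXIT LAWS AGREE** (`T ≥ 2`).  For ANY positive left fixed vector `ℓ` of the critical kernel `Iinf T y_T` and all levels `a, b`:
among the critical bridges from level `a` with exactly `m` surface CONTACTS the fraction ending at level `b` tends to `ℓ_b / Σ_{b′} ℓ_{b′}`,
and among those with exactly `2k + χ_a − χ_b` STEPS it tends to `ℓ_b / Σ_{b′ ≡ b} ℓ_{b′}` — ONE vector `ℓ` for both gradings (the tree's
`exists_tendsto_hbCoeff_exitLaw` and `exists_tendsto_LUM_exitLaw` each had their own unidentified `ℓ`, `ℓ′`).  The end level of a long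
critical bridge does not remember whether «long» was measured in contacts or in steps (up to the parity constraint of the length grading).
ERRATUM carried from edition 1 (ref g68, 2026-08-27): in the docstrings of §2 / §4 the locator for «finite derivative at the convergence
parameter» is Seneta (1973) §6.2 **Theorem 6.4** (R-positivity ⟺ `y′x < ∞`); Theorem 6.3 is the positive sub-invariant pair.
[cite: Seneta1973, §6.2 Theorems 6.3–6.4; Feller1968, XIII.3; DuminilCopinHammond2013, §2.2; lane «pcv-sawmu» a-p2 g23 — own result] -/
theorem exitLaws_agree (hT : 2 ≤ T) (hℓ0 : ∀ b, 0 < ℓ b) (hℓ : ℓ ᵥ* Iinf T (stripYT T) = ℓ) (a b : Fin (2 * T)) :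
    Tendsto (fun m : ℕ => hbCoeff T m a b / ∑ b', hbCoeff T m a b') atTop (𝓝 (ℓ b / ∑ b', ℓ b')) ∧
      Tendsto (fun k : ℕ => LUM T (2 * k + 1) (2 * (k : ℤ) + lchi a - lchi b) (stripYT T) a b /
          ∑ b', LUM T (2 * k + 1) (2 * (k : ℤ) + lchi a - lchi b) (stripYT T) a b') atTop
        (𝓝 (ℓ b / ∑ b' ∈ univ.filter (fun b' => lchi b' = lchi b), ℓ b')) := by
  classical
  have hT1 : 1 ≤ T := by omega
  have hyT0 : 0 < stripYT T := stripYT_pos hT1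
  haveI : Nonempty (Fin (2 * T)) := ⟨⟨0, by omega⟩⟩
  -- a positive right fixed vector to run the explicit laws (the statement does not depend on it)
  obtain ⟨u, -, hu0, -, hu, -⟩ := exists_pos_fixed_vectors_Iinf_stripYT hT
  obtain ⟨hc, -⟩ := tendsto_hKernel_residue_explicit hT hu0 hℓ0 hu hℓ
  obtain ⟨hl, -⟩ := tendsto_stripLenD_residue_explicit hT hu0 hℓ0 hu hℓ
  set dc := ℓ ⬝ᵥ ((Matrix.of fun a b : Fin (2 * T) => ∑' j : ℕ, (j : ℝ) * irCoeff T j a b * stripYT T ^ (j - 1)) *ᵥ u)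
  set dl := ℓ ⬝ᵥ ((Matrix.of fun a b : Fin (2 * T) => ∑' n : ℕ, (n : ℝ) * LMM T n (n : ℤ) (stripYT T) a b) *ᵥ u)
  have hlaw := fun b' => bridge_amplitudes_explicit hT hu0 hℓ0 hu hℓ a b'
  refine ⟨?_, ?_⟩
  · -- contacts
    have hℓs : 0 < ∑ b', ℓ b' := sum_pos (fun b' _ => hℓ0 b') univ_nonempty
    have hsum : Tendsto (fun m : ℕ => ∑ b', hbCoeff T m a b' * stripYT T ^ m) atTop (𝓝 (∑ b', u a * ℓ b' / dc / stripYT T)) :=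
      tendsto_finsetSum _ fun b' _ => (hlaw b').1
    have hne : ∑ b', u a * ℓ b' / dc / stripYT T ≠ 0 := by
      rw [← sum_div, ← sum_div, ← mul_sum]
      exact (div_pos (div_pos (mul_pos (hu0 a) hℓs) hc) hyT0).ne'
    have hlim := ((hlaw b).1).div hsum hne
    have heq : u a * ℓ b / dc / stripYT T / ∑ b', u a * ℓ b' / dc / stripYT T = ℓ b / ∑ b', ℓ b' := by
      rw [← sum_div, ← sum_div, ← mul_sum]
      have hua : u a ≠ 0 := (hu0 a).ne'
      field_simp
    rw [heq] at hlim
    exact hlim.congr fun m => by rw [Pi.div_apply, ← sum_mul, mul_div_mul_right _ _ (pow_ne_zero m hyT0.ne')]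
  · -- steps: endpoints of the other parity carry no weight
    have hden : Tendsto (fun k : ℕ => ∑ b', LUM T (2 * k + 1) (2 * (k : ℤ) + lchi a - lchi b) (stripYT T) a b') atTop
        (𝓝 (∑ b', if lchi b' = lchi b then 2 * (u a * ℓ b' / dl) else 0)) := by
      refine tendsto_finsetSum _ fun b' _ => ?_
      split_ifs with hb'
      · rw [← hb']; exact (hlaw b').2
      · refine tendsto_const_nhds.congr fun k => ?_
        refine ((LUM_LMM_eq_zero_of_not_even (stripYT T) a b' fun ⟨m, hm⟩ => hb' ?_).1).symm
        obtain ⟨ja, hja⟩ := (lchi_facts a).2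
        obtain ⟨jb, hjb⟩ := (lchi_facts b').2
        have h1 := (lchi_facts b').1; have h2 := (lchi_facts b).1
        omega
    have hS : ∑ b', (if lchi b' = lchi b then 2 * (u a * ℓ b' / dl) else 0) =
        2 * u a / dl * ∑ b' ∈ univ.filter (fun b' => lchi b' = lchi b), ℓ b' := by
      rw [← sum_filter, mul_sum]
      exact sum_congr rfl fun b' _ => by ring
    have hSpos : 0 < ∑ b' ∈ univ.filter (fun b' => lchi b' = lchi b), ℓ b' :=
      lt_of_lt_of_le (hℓ0 b) (single_le_sum (f := ℓ) (fun b' _ => (hℓ0 b').le) (mem_filter.2 ⟨mem_univ b, rfl⟩))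
    rw [hS] at hden
    have hne : 2 * u a / dl * ∑ b' ∈ univ.filter (fun b' => lchi b' = lchi b), ℓ b' ≠ 0 := by
      have := hu0 a; positivity
    have h := ((hlaw b).2).div hden hne
    refine h.congr' (Eventually.of_forall fun k => rfl) |>.trans ?_
    rw [show 2 * (u a * ℓ b / dl) / (2 * u a / dl * ∑ b' ∈ univ.filter (fun b' => lchi b' = lchi b), ℓ b') =
        ℓ b / ∑ b' ∈ univ.filter (fun b' => lchi b' = lchi b), ℓ b' by
      have := hu0 a; have := hl; field_simp]

/-- ★★ **THE ENTRANCE LAWS AGREE** (`T ≥ 2`): for ANY positive right fixed vector `u` of `Iinf T y_T` and all levels `a, b`, among the critical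
bridges INTO level `b` with exactly `m` contacts the fraction starting from level `a` tends to `u_a / Σ_{a′} u_{a′}`, and among those with
exactly `2k + χ_a − χ_b` steps it tends to `u_a / Σ_{a′ ≡ a} u_{a′}` — one vector `u` for both gradings.
[cite: Seneta1973, §6.2 Theorems 6.3–6.4; Feller1968, XIII.3; DuminilCopinHammond2013, §2.2; lane «pcv-sawmu» a-p2 g23 — own result] -/
theorem entranceLaws_agree (hT : 2 ≤ T) (hu0 : ∀ a, 0 < u a) (hu : Iinf T (stripYT T) *ᵥ u = u) (a b : Fin (2 * T)) :
    Tendsto (fun m : ℕ => hbCoeff T m a b / ∑ a', hbCoeff T m a' b) atTop (𝓝 (u a / ∑ a', u a')) ∧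
      Tendsto (fun k : ℕ => LUM T (2 * k + 1) (2 * (k : ℤ) + lchi a - lchi b) (stripYT T) a b /
          ∑ a', LUM T (2 * k + 1) (2 * (k : ℤ) + lchi a - lchi b) (stripYT T) a' b) atTop
        (𝓝 (u a / ∑ a' ∈ univ.filter (fun a' => lchi a' = lchi a), u a')) := by
  classical
  have hT1 : 1 ≤ T := by omega
  have hyT0 : 0 < stripYT T := stripYT_pos hT1
  haveI : Nonempty (Fin (2 * T)) := ⟨⟨0, by omega⟩⟩
  obtain ⟨-, ℓ, -, hℓ0, -, hℓ⟩ := exists_pos_fixed_vectors_Iinf_stripYT hT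
  obtain ⟨hc, -⟩ := tendsto_hKernel_residue_explicit hT hu0 hℓ0 hu hℓ
  obtain ⟨hl, -⟩ := tendsto_stripLenD_residue_explicit hT hu0 hℓ0 hu hℓ
  set dc := ℓ ⬝ᵥ ((Matrix.of fun a b : Fin (2 * T) => ∑' j : ℕ, (j : ℝ) * irCoeff T j a b * stripYT T ^ (j - 1)) *ᵥ u)
  set dl := ℓ ⬝ᵥ ((Matrix.of fun a b : Fin (2 * T) => ∑' n : ℕ, (n : ℝ) * LMM T n (n : ℤ) (stripYT T) a b) *ᵥ u)
  have hlaw := fun a' => bridge_amplitudes_explicit hT hu0 hℓ0 hu hℓ a' b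
  refine ⟨?_, ?_⟩
  · have hus : 0 < ∑ a', u a' := sum_pos (fun a' _ => hu0 a') univ_nonempty
    have hsum : Tendsto (fun m : ℕ => ∑ a', hbCoeff T m a' b * stripYT T ^ m) atTop (𝓝 (∑ a', u a' * ℓ b / dc / stripYT T)) :=
      tendsto_finsetSum _ fun a' _ => (hlaw a').1
    have hne : ∑ a', u a' * ℓ b / dc / stripYT T ≠ 0 := by
      rw [← sum_div, ← sum_div, ← sum_mul]
      exact (div_pos (div_pos (mul_pos hus (hℓ0 b)) hc) hyT0).ne'
    have hlim := ((hlaw a).1).div hsum hne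
    have heq : u a * ℓ b / dc / stripYT T / ∑ a', u a' * ℓ b / dc / stripYT T = u a / ∑ a', u a' := by
      rw [← sum_div, ← sum_div, ← sum_mul]
      have hlb : ℓ b ≠ 0 := (hℓ0 b).ne'
      field_simp
    rw [heq] at hlim
    exact hlim.congr fun m => by rw [Pi.div_apply, ← sum_mul, mul_div_mul_right _ _ (pow_ne_zero m hyT0.ne')]
  · have hden : Tendsto (fun k : ℕ => ∑ a', LUM T (2 * k + 1) (2 * (k : ℤ) + lchi a - lchi b) (stripYT T) a' b) atTop
        (𝓝 (∑ a', if lchi a' = lchi a then 2 * (u a' * ℓ b / dl) else 0)) := by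
      refine tendsto_finsetSum _ fun a' _ => ?_
      split_ifs with ha'
      · rw [← ha']; exact (hlaw a').2
      · refine tendsto_const_nhds.congr fun k => ?_
        refine ((LUM_LMM_eq_zero_of_not_even (stripYT T) a' b fun ⟨m, hm⟩ => ha' ?_).1).symm
        obtain ⟨ja, hja⟩ := (lchi_facts a').2
        obtain ⟨jb, hjb⟩ := (lchi_facts b).2
        have h1 := (lchi_facts a').1; have h2 := (lchi_facts a).1; have h3 := (lchi_facts b).1
        omega
    have hS : ∑ a', (if lchi a' = lchi a then 2 * (u a' * ℓ b / dl) else 0) =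
        2 * ℓ b / dl * ∑ a' ∈ univ.filter (fun a' => lchi a' = lchi a), u a' := by
      rw [← sum_filter, mul_sum]
      exact sum_congr rfl fun a' _ => by ring
    have hSpos : 0 < ∑ a' ∈ univ.filter (fun a' => lchi a' = lchi a), u a' :=
      lt_of_lt_of_le (hu0 a) (single_le_sum (f := u) (fun a' _ => (hu0 a').le) (mem_filter.2 ⟨mem_univ a, rfl⟩))
    rw [hS] at hden
    have hne : 2 * ℓ b / dl * ∑ a' ∈ univ.filter (fun a' => lchi a' = lchi a), u a' ≠ 0 := by
      have := hℓ0 b; positivity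
    have h := ((hlaw a).2).div hden hne
    refine h.congr' (Eventually.of_forall fun k => rfl) |>.trans ?_
    rw [show 2 * (u a * ℓ b / dl) / (2 * ℓ b / dl * ∑ a' ∈ univ.filter (fun a' => lchi a' = lchi a), u a') =
        u a / ∑ a' ∈ univ.filter (fun a' => lchi a' = lchi a), u a' by
      have := hℓ0 b; have := hl; field_simp]

end ExitLaws

end HV

end Literature.Probability.RandomPlanarGeometry.SAW
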